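import Literature.Analysis.Hypoelliptic.SchwartzBridge
import Literature.Analysis.Hypoelliptic.KernelComposition
import Literature.Analysis.Hypoelliptic.EnergyInequality
import Mathlib.Analysis.Fourier.FourierTransformDeriv
import Mathlib.Analysis.Distribution.SchwartzSpace.Fourier
import HarnessLib

/-!
# Sup norms of derivatives of Fourier transforms, controlled by weighted `L²` norms

Analysis/Hypoelliptic support file serving the discharge of
`Literature.Analysis.Distribution.Hormander1967_thm11` (the finite-order interface between
distributions and the weighted-`L²` calculus).

For a Schwartz function `ψ` on `V` (dimension `n`) and `r > n/2`:

* `∫ ⟨v⟩^p ‖ψ v‖ dv ≤ C_r ‖ψ‖_{p+r}` (Cauchy–Schwarz with `⟨·⟩^{-r} ∈ L²`,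
  `integral_bw_norm_le_rn`);
* **`sup_x ‖D^j (𝓕ψ)(x)‖ ≤ C ‖ψ‖_{j + r}`** (`norm_iteratedFDeriv_fourier_le_rn`), from Mathlib's
  `Real.pow_mul_norm_iteratedFDeriv_fourier_le`.

## References

* L. Hörmander, *The Analysis of Linear Partial Differential Operators I*, Lemma 7.1.3 (folklore).
-/

noncomputable section

open MeasureTheory Set Filter Function SchwartzMap Real
open scoped ENNReal NNReal Topology ComplexConjugate InnerProductSpace FourierTransform BigOperators

namespace Literature.Analysis.Hypoelliptic

variable {V : Type*} [NormedAddCommGroup V] [InnerProductSpace ℝ V] [FiniteDimensional ℝ V]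
  [MeasurableSpace V] [BorelSpace V]

/-! ### Cauchy–Schwarz against the decay weight -/

variable (V) in
/-- The `L²` mass of `⟨·⟩^{-r}`: `(∫ ⟨v⟩^{-2r} dv)^{1/2}`. [folklore] -/
def decayL2 (r : ℝ) : ℝ≥0∞ := (∫⁻ v : V, ENNReal.ofReal (bw (-r) v) ^ (2 : ℝ)) ^ ((1 : ℝ) / 2)

/-- `decayL2 r < ∞` for `r > n/2`. [folklore] -/
theorem decayL2_lt_top {r : ℝ} (hr : (Module.finrank ℝ V : ℝ) < 2 * r) : decayL2 V r < ∞ := by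
  unfold decayL2
  refine ENNReal.rpow_lt_top_of_nonneg (by norm_num) (ne_of_lt ?_)
  have hi := (integrable_bw_neg (V := V) hr).lintegral_lt_top
  refine lt_of_le_of_lt (le_of_eq ?_) hi
  refine lintegral_congr fun v => ?_
  rw [ENNReal.ofReal_rpow_of_nonneg (bw_nonneg _ v) (by norm_num)]
  congr 1
  rw [bw, bw, ← Real.rpow_mul (one_add_norm_sq_pos v).le]
  ring_nf

/-- **`∫ ⟨v⟩^p ‖ψ v‖ ≤ decayL2 r · ‖ψ‖_{p+r}`** (as extended reals). [folklore] -/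
theorem lintegral_bw_norm_le (p r : ℝ) {ψ : V → ℂ} (hψ : AEStronglyMeasurable ψ (volume : Measure V)) :
    ∫⁻ v : V, ENNReal.ofReal (bw p v * ‖ψ v‖) ≤ decayL2 V r * wnorm (p + r) ψ := by
  -- split `⟨v⟩^p ‖ψ‖ = ⟨v⟩^{-r} · (⟨v⟩^{p+r} ‖ψ‖)`
  have hsplit : ∀ v, ENNReal.ofReal (bw p v * ‖ψ v‖) =
      ENNReal.ofReal (bw (-r) v) * ‖(bw (p + r) v : ℂ) * ψ v‖ₑ := fun v => by
    rw [enorm_bw_mul, ← ofReal_norm, ← ENNReal.ofReal_mul (bw_nonneg _ v),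
      ← ENNReal.ofReal_mul (bw_nonneg _ v), ← mul_assoc, ← bw_add,
      show -r + (p + r) = p by ring]
  simp_rw [hsplit]
  have hf : AEMeasurable (fun v : V => ENNReal.ofReal (bw (-r) v)) (volume : Measure V) :=
    (continuous_bw (-r)).measurable.ennreal_ofReal.aemeasurable
  have hg : AEMeasurable (fun v : V => ‖(bw (p + r) v : ℂ) * ψ v‖ₑ) (volume : Measure V) :=
    ((Complex.continuous_ofReal.comp (continuous_bw (p + r))).aestronglyMeasurable.mul hψ).enorm
  have h := ENNReal.lintegral_mul_le_Lp_mul_Lq (volume : Measure V) Real.HolderConjugate.two_two hf hg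
  refine h.trans (le_of_eq ?_)
  have e1 : (∫⁻ a : V, ENNReal.ofReal (bw (-r) a) ^ (2 : ℝ)) ^ ((1 : ℝ) / 2) = decayL2 V r := rfl
  have e2 : (∫⁻ a : V, ‖(bw (p + r) a : ℂ) * ψ a‖ₑ ^ (2 : ℝ)) ^ ((1 : ℝ) / 2) = wnorm (p + r) ψ := by
    rw [wnorm_eq_lintegral, one_div]
    congr 1
    refine lintegral_congr fun v => ?_
    rw [enorm_bw_mul, ENNReal.rpow_two]
  rw [e1, e2]

/-- Real form: `∫ ⟨v⟩^p ‖ψ v‖ ≤ (decayL2 r).toReal · ‖ψ‖_{p+r}` for `ψ ∈ Nice`, `r > n/2`. [folklore] -/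
theorem integral_bw_norm_le_rn {r : ℝ} (hr : (Module.finrank ℝ V : ℝ) < 2 * r) (p : ℝ) {ψ : V → ℂ}
    (hψ : Nice ψ) (hint : Integrable (fun v : V => bw p v * ‖ψ v‖) (volume : Measure V)) :
    ∫ v : V, bw p v * ‖ψ v‖ ≤ (decayL2 V r).toReal * rn (p + r) ψ := by
  have hnn : 0 ≤ᵐ[(volume : Measure V)] fun v : V => bw p v * ‖ψ v‖ :=
    Eventually.of_forall fun v => mul_nonneg (bw_nonneg p v) (norm_nonneg _)
  rw [integral_eq_lintegral_of_nonneg_ae hnn hint.aestronglyMeasurable]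
  have h := lintegral_bw_norm_le p r hψ.1
  have hfin : decayL2 V r * wnorm (p + r) ψ ≠ ∞ :=
    ENNReal.mul_ne_top (decayL2_lt_top hr).ne (hψ.2 _).ne
  have := ENNReal.toReal_mono hfin h
  rwa [ENNReal.toReal_mul] at this

/-! ### Sup norms of derivatives of Fourier transforms -/

omit [InnerProductSpace ℝ V] [MeasurableSpace V] [BorelSpace V] [FiniteDimensional ℝ V] in
/-- `‖v‖^p ≤ ⟨v⟩^p`. [folklore] -/
theorem norm_pow_le_bw (p : ℕ) (v : V) : ‖v‖ ^ p ≤ bw p v := by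
  have h1 : ‖v‖ ≤ bw 1 v := by
    rw [bw_one]
    calc ‖v‖ = Real.sqrt (‖v‖ ^ 2) := (Real.sqrt_sq (norm_nonneg v)).symm
      _ ≤ Real.sqrt (1 + ‖v‖ ^ 2) := Real.sqrt_le_sqrt (by linarith)
  calc ‖v‖ ^ p ≤ bw 1 v ^ p := pow_le_pow_left₀ (norm_nonneg v) h1 p
    _ = bw p v := by
        rw [bw, bw, ← Real.rpow_natCast, ← Real.rpow_mul (one_add_norm_sq_pos v).le]; ring_nf

/-- **`sup_x ‖D^j (𝓕ψ)(x)‖ ≤ C ‖ψ‖_{j + r}`** for Schwartz `ψ`, `r > n/2`. [folklore] -/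
theorem norm_iteratedFDeriv_fourier_le_rn {r : ℝ} (hr : (Module.finrank ℝ V : ℝ) < 2 * r) (j : ℕ) :
    ∃ C : ℝ, 0 ≤ C ∧ ∀ (ψ : 𝓢(V, ℂ)) (x : V),
      ‖iteratedFDeriv ℝ j (𝓕 (ψ : V → ℂ)) x‖ ≤ C * rn ((j : ℝ) + r) (ψ : V → ℂ) := by
  refine ⟨(2 * π) ^ j * ((j + 1) * (decayL2 V r).toReal), by positivity, fun ψ x => ?_⟩
  set f : V → ℂ := ⇑ψ with hf
  have hψ : Nice f := SchwartzMap.nice ψ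
  have h'f : ∀ (k n : ℕ), (k : ℕ∞) ≤ (j : ℕ∞) → (n : ℕ∞) ≤ (0 : ℕ∞) →
      Integrable (fun v => ‖v‖ ^ k * ‖iteratedFDeriv ℝ n f v‖) (volume : Measure V) :=
    fun k n _ _ => ψ.integrable_pow_mul_iteratedFDeriv volume k n
  have h := Real.pow_mul_norm_iteratedFDeriv_fourier_le (f := f) (K := j) (N := 0)
    (ψ.smooth 0) h'f le_rfl le_rfl x
  simp only [pow_zero, mul_one, one_mul, zero_add, Finset.range_one] at h
  -- each term of the sum
  have hterm : ∀ k, k ≤ j → ∫ v, ‖v‖ ^ k * ‖iteratedFDeriv ℝ 0 f v‖ ≤ (decayL2 V r).toReal * rn ((j : ℝ) + r) f := by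
    intro k hkj
    have hint : Integrable (fun v : V => bw k v * ‖f v‖) (volume : Measure V) := by
      have := (bwSchwartz k ψ).integrable (μ := (volume : Measure V))
      refine (this.norm).congr (Eventually.of_forall fun v => ?_)
      simp only [bwSchwartz_apply, norm_mul, Complex.norm_real, Real.norm_eq_abs,
        abs_of_nonneg (bw_nonneg _ v)]
      rfl
    have h1 : ∫ v, ‖v‖ ^ k * ‖iteratedFDeriv ℝ 0 f v‖ ≤ ∫ v, bw k v * ‖f v‖ := by
      refine integral_mono_of_nonneg (Eventually.of_forall fun v => by positivity) hint
        (Eventually.of_forall fun v => ?_)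
      show ‖v‖ ^ k * ‖iteratedFDeriv ℝ 0 f v‖ ≤ bw k v * ‖f v‖
      rw [norm_iteratedFDeriv_zero]
      exact mul_le_mul_of_nonneg_right (norm_pow_le_bw k v) (norm_nonneg _)
    have h2 : ∫ v, bw k v * ‖f v‖ ≤ (decayL2 V r).toReal * rn ((k : ℝ) + r) f :=
      integral_bw_norm_le_rn hr k hψ hint
    have hkj' : (k : ℝ) + r ≤ (j : ℝ) + r := by
      have : (k : ℝ) ≤ (j : ℝ) := by exact_mod_cast hkj
      linarith
    have h3 : rn ((k : ℝ) + r) f ≤ rn ((j : ℝ) + r) f := rn_mono hkj' hψ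
    exact h1.trans (h2.trans (mul_le_mul_of_nonneg_left h3 ENNReal.toReal_nonneg))
  have hsum : ∑ p ∈ Finset.range (j + 1) ×ˢ ({0} : Finset ℕ),
      ∫ v, ‖v‖ ^ p.1 * ‖iteratedFDeriv ℝ p.2 f v‖ ≤ (j + 1) * ((decayL2 V r).toReal * rn ((j : ℝ) + r) f) := by
    rw [Finset.sum_product]
    simp only [Finset.sum_singleton]
    calc ∑ k ∈ Finset.range (j + 1), ∫ v, ‖v‖ ^ k * ‖iteratedFDeriv ℝ 0 f v‖
        ≤ ∑ _k ∈ Finset.range (j + 1), (decayL2 V r).toReal * rn ((j : ℝ) + r) f :=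
          Finset.sum_le_sum fun k hk => hterm k (Nat.lt_succ_iff.1 (Finset.mem_range.1 hk))
      _ = (j + 1) * ((decayL2 V r).toReal * rn ((j : ℝ) + r) f) := by
          rw [Finset.sum_const, Finset.card_range, nsmul_eq_mul]; push_cast; ring
  calc ‖iteratedFDeriv ℝ j (𝓕 f) x‖ ≤ (2 * π) ^ j * ∑ p ∈ Finset.range (j + 1) ×ˢ ({0} : Finset ℕ),
        ∫ v, ‖v‖ ^ p.1 * ‖iteratedFDeriv ℝ p.2 f v‖ := h
    _ ≤ (2 * π) ^ j * ((j + 1) * ((decayL2 V r).toReal * rn ((j : ℝ) + r) f)) :=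
        mul_le_mul_of_nonneg_left hsum (by positivity)
    _ = _ := by ring

end Literature.Analysis.Hypoelliptic
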